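import Summits.ABC.StewartYu.PadicTwoRecordNumerics
import Summits.ABC.StewartYu.PadicTwoJunctions
import Summits.ABC.StewartYu.PadicTwoFinal
import Summits.ABC.StewartYu.PadicTwoRecord
import Summits.ABC.StewartYu.PadicW80Sizes3D
import Summits.ABC.StewartYu.PadicTwistFinal
import HarnessLib

/-!
# Cell abc-stewartyu, W80Two (xi): the parameter pack of the `2`-adic machine at p1's `q = 3` record —
# ALL inputs of `TwoSetup.main3` discharged; packs exist; the core bound and THE ENGINE at `p = 2`

`Summits/ABC/StewartYu/PadicTwoPack.lean` — cell `abc-stewartyu` (HOME `run/shared/lean/pub/abc-stewartyu/`,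
seat p4; route `PadicPrimesW80TwoThirds`, crux `W80Two` stmt-ABC-19486; theorems only, no named fact).  TWIN of p1's `PadicTwistPMPack.lean` / p2's `PadicTwistPack.lean` for lit's
`S : TwoSetup` (`p = 2`, integer generators `≡ 1 (mod 8)`, cube-Kummer condition, NO class) on p1's base-`3`
record `PadicW80Par3*` (the landed structure `PadicW80ParL S.d` at `ℓ = 1`, `Mcl = 1`), the machine run at HALF
multiplicity `t_J := ⌊tJ3 J/2⌋` (p1-g5's ruling, 2026-08-26: p2-g3's `KFinal3` conditions at the RANGE
`N = (3/2)·#nodes`; the gain `log 4` per zero pays for the halving).  Junctions: `kSizes3_of_hyp` (denominators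
`SetupQ.Dclear3 J ≤ DmaxK3 k`, `|coreSum3| ≤ #box3·PrV3·𝔔⁵E(3^{k+1}) ≤ MmaxK3 k`), `kFinal3_of_hyp`
(`kFinal3_of_log_ineq` with p1's `kstep3_h1/h2`), `siegel3_of_hyp` (`siegel3_of_count` with p1's
`padic_siegel_count3`, `Dc := Dclear3 0`, `Amax3`; `Pint3 := ⌈#box3₀·Amax3⌉ ≤ PrV3`), `thirdStep_of_hyp`
(`thirdStep_of_numerics` with `D := Dclear3 J`, `Mb := max(MmaxT3, ·)`, `thirdFinal3_of_log_ineq` at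
`(3^{d+J}S₀, ⌊t_J/2⌋, 3^{d+2} − 1, DmaxT3, MmaxT3, ∏ max(1,|allᵢ|))` fed by `kstep3_h1/h2` at `k = d` and
`bthird_le_budget3'`, and `SetupQ.thirdThreshold_anti`), `endgame3_of_params` (`endgame3_of_numbers` with
`endgame_numbers3`); then **`paramPack3_nonempty : Nonempty (S.ParamPack3 P.Uℓ)`**, `norm_Λ₀_gt_two`, and the tail (p3-g3's
composition on `recordOf`/`recordOf_U_le`): **`packs_exist_two`**, **`twoCoreBound_holds : TwoCoreBound (2·Cw)`**,
**`engineTwoW80`** — the hypothesis of lit's `YuNinetyW80.two_of_w80Engine_int'`.  The per-unknown archimedean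
sizes are p5's `PadicW80Sizes3C/3D`.

## References
* [Yu1989] K. Yu, *Linear forms in p-adic logarithms*, Acta Arith. 53 (1989), §3 (the `q`-descent).
* [Yu1990] K. Yu, *Linear forms in p-adic logarithms II*, Compositio Math. 74 (1990), Theorem 2.1, §3.
* [Waldschmidt1980] M. Waldschmidt, *A lower bound for linear forms in logarithms*, Acta Arith. 37 (1980),
  Prop. 3.8 and §§3.2–3.5 (pp. 263–274).
-/


noncomputable section

open Finset Height
open Literature.NumberTheory.Transcendental
open Literature.NumberTheory.Transcendental.CW77 (heightProd hgt one_le_hgt abs_le_hgt hgt_pos)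
open Literature.NumberTheory.Transcendental.CW77.Setup (Idx Tau tauNorm tauSet mem_tauSet)
open Literature.NumberTheory.Transcendental.PadicCW77 (condExp)

namespace Summit.ABC.StewartYu

namespace TwoSetup

variable {S : TwoSetup} {P : PadicW80ParL S.d} (hy : S.toQ.flat.SizeHyp P.V P.Vθ P.W)

/-! ### The integer coefficient bound of Siegel's step -/

/-- **The integer coefficient bound of Siegel's step** `Pint3 = ⌈#box3₀ · Amax3⌉` is `≤ PrV3`
(`#box3₀ ≤ 𝔔`, `𝔔 · Amax3 + 1 ≤ PrV3`). [folklore] -/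
theorem Pint3_le_PrV3 (S : TwoSetup) (P : PadicW80ParL S.d) :
    ((⌈((S.toQ.box3 (h := P.hparℓ) (Lb := P.Lb3) P.L3 P.Lθ3 0).card : ℝ) * P.Amax3⌉ : ℤ) : ℝ) ≤ P.PrV3 := by
  have hcard := S.toQ.card_box3_le_𝔔3 P 0
  have hA := P.Amax3_pos
  have h1 : ((S.toQ.box3 (h := P.hparℓ) (Lb := P.Lb3) P.L3 P.Lθ3 0).card : ℝ) * P.Amax3 ≤ P.𝔔3 * P.Amax3 :=
    mul_le_mul_of_nonneg_right hcard hA.le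
  have h2 := P.𝔔3_mul_Amax3_add_one_le
  have h3 := Int.ceil_lt_add_one (((S.toQ.box3 (h := P.hparℓ) (Lb := P.Lb3) P.L3 P.Lθ3 0).card : ℝ) * P.Amax3)
  linarith

/-- `0 ≤ Pint3`. [folklore] -/
theorem Pint3_nonneg (S : TwoSetup) (P : PadicW80ParL S.d) :
    (0 : ℝ) ≤ ((⌈((S.toQ.box3 (h := P.hparℓ) (Lb := P.Lb3) P.L3 P.Lθ3 0).card : ℝ) * P.Amax3⌉ : ℤ) : ℝ) := by
  have hA := P.Amax3_pos
  exact_mod_cast Int.ceil_nonneg (by positivity)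

/-! ### The archimedean sizes of the inner steps -/

include hy in
/-- **The archimedean sizes of the inner steps at the record** (the `hsz` field): for coefficients `pv` of
level `J < J₀` with `|pv(u)| ≤ Pint ≤ PrV3`, at step `k < d` the integer `Dclear3_J(s₁,τ) ≤ DmaxK3 k` clears
`coreSum3` and `|coreSum3| ≤ #box3·PrV3·𝔔⁵E(3^{k+1}) ≤ MmaxK3 k` (p2-g3's `kSizes3_of_bounds` with p5's
per-unknown sizes and `#box3_J ≤ 𝔔`). [cite: Waldschmidt1980, §3.4 (3.19)–(3.21) (p. 269)] [cite: Yu1989, §3 Lemma 3.3] -/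
theorem kSizes3_of_hyp {J : ℕ} (hJ : J < P.J₀3) (t : ℕ) {Pint : ℤ} (hPint : (Pint : ℝ) ≤ P.PrV3)
    {pv : Idx S.d P.hparℓ P.Lb3 → ℤ} (inv : S.toQ.Inv3 P.J₀3 P.L3 P.Lθ3 P.S₀3 P.T3 Pint J pv) :
    S.KSizes3 P.J₀3 J P.L3 P.Lθ3 P.S₀3 P.T3 t pv P.DmaxK3 P.MmaxK3 := by
  have hτT : ∀ {τ : Tau S.d} {k : ℕ}, tauNorm τ + t ≤ P.T3 / 3 ^ J - k * t → tauNorm τ ≤ P.T3 :=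
    fun h => by have := Nat.div_le_self P.T3 (3 ^ J); omega
  refine S.kSizes3_of_bounds inv hPint (Qmax := fun k => P.𝔔3 ^ 5 * P.Efac3 ((3 ^ (k + 1) : ℕ) : ℝ))
    (fun k hk τ hτ s₁ hs₁ _ => hy.Dclear3_le_DmaxK3 (hτT hτ) hs₁)
    (fun k hk τ hτ s₁ hs₁ _ u hu => hy.abs_qTerm3_le hJ.le hk.le hu (hτT hτ) hs₁) fun k _ => ?_
  have hcard := S.toQ.card_box3_le_𝔔3 P J
  have hPr : (0 : ℝ) ≤ P.PrV3 := P.PrV3_pos.le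
  have hB0 : (0 : ℝ) ≤ P.𝔔3 ^ 5 * P.Efac3 ((3 ^ (k + 1) : ℕ) : ℝ) := by
    have := P.𝔔3_pos; have := P.Efac3_pos ((3 ^ (k + 1) : ℕ) : ℝ); positivity
  unfold PadicW80ParL.MmaxK3
  calc ((S.toQ.box3 (h := P.hparℓ) (Lb := P.Lb3) P.L3 P.Lθ3 J).card : ℝ) * P.PrV3 *
        (P.𝔔3 ^ 5 * P.Efac3 ((3 ^ (k + 1) : ℕ) : ℝ))
      ≤ P.𝔔3 * P.PrV3 * (P.𝔔3 ^ 5 * P.Efac3 ((3 ^ (k + 1) : ℕ) : ℝ)) := by gcongr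

/-! ### Siegel's lemma at level `0` -/

include hy in
/-- **Siegel's lemma at level `0` at the record** (the `hsiegel` field; no class at `p = 2`): integers `pv(u)`
on the whole box of level `0`, `|pv(u)| ≤ Pint3 = ⌈#box3₀ · Amax3⌉` — p1's `siegel3_of_record` (the count is
discharged there) with the clearing denominators `Dclear3₀(s,τ)` (p2-g3) and p5's coefficient bound
`|Dclear3₀ · qTerm3| ≤ Amax3`. [cite: Yu1989, §3 Lemma 3.1] [cite: Waldschmidt1980, Lemma 3.2 (pp. 266–267)] -/
theorem siegel3_of_hyp : S.Siegel3 (h := P.hparℓ) (Lb := P.Lb3) P.J₀3 P.L3 P.Lθ3 P.S₀3 P.T3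
      ⌈((S.toQ.box3 (h := P.hparℓ) (Lb := P.Lb3) P.L3 P.Lθ3 0).card : ℝ) * P.Amax3⌉ :=
  S.siegel3_of_record P (fun s τ => S.toQ.Dclear3 (h := P.hparℓ) 0 P.L3 P.Lθ3 s τ)
    (fun s _ _ τ _ => S.toQ.Dclear3_pos 0 P.L3 P.Lθ3 s τ)
    (fun s _ _ τ _ _ hu => S.toQ.exists_int_Dclear3_mul_qTerm3 P.J₀3 0 hu τ s)
    P.one_le_Amax3 (fun _ hs _ _ hτ _ hu => hy.abs_Dclear3_qTerm3_le_Amax3 hs hτ hu)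

/-! ### The third step -/

/-- `DmaxK3 0 = DmaxT3` (`E(3¹) = E(3)`). [folklore] -/
theorem DmaxK3_zero (P : PadicW80ParL S.d) : P.DmaxK3 0 = P.DmaxT3 := by
  unfold PadicW80ParL.DmaxK3 PadicW80ParL.DmaxT3; norm_num

include hy in
/-- **The third step at level `J < J₀` at the record** (the `hthird` field), from the cube-Kummer condition of
INTEGER generators and the smallness `‖Λ₀‖₂ ≤ e^{−U}`: p2-g3's `thirdStep_of_numerics` with the per-`(s,τ)`
denominators `D(s,τ) := Dclear3_J(s,τ)` (`exists_int_Dclear3_mul_thirdWeight`; `≤ DmaxT3` on the relevant range)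
and majorants `Mb(s,τ) := max(MmaxT3, ∑_u Pint3·|qΔ3_{J+1} qA♭ qEt|)` (`= MmaxT3` on the relevant range:
`#box3 ≤ 𝔔`, p5's `|qΔ3_{J+1} qA♭ qEt| ≤ RThird3`), the third-point inequality `thirdFinal3_of_log_ineq` at
`(N, t, E, D, M, Hp) = (3^{d+J}S₀, ⌊t_J/2⌋, 3^{d+2} − 1, DmaxT3, MmaxT3, ∏ max(1,|allᵢ|))` fed by p1's
`third3_h1/third3_h2`, and `SetupQ.thirdThreshold_anti` carrying the closed forms to `(D(s,τ), Mb(s,τ))`.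
(p2-g3's one-call `thirdStep_of_log_ineq` wants GLOBAL majorants `D ≤ Dmax`, `Mb ≤ Mmax`, which the actual
denominators do not admit — hence the `max` device of p1's `PadicTwistPMPack`.) [cite: Yu1989, §3 Lemmas 3.4–3.5]
[cite: Waldschmidt1980, Lemma 3.7 (pp. 272–273)] -/
theorem thirdStep_of_hyp (hℓ1 : P.ℓ = 1) (hint : ∀ i, ∃ a : ℤ, S.toQ.all i = a)
    (hind : ∀ κ : Fin (S.d + 1) → ℕ, (∃ j, ¬ 3 ∣ κ j) → ∀ γ : ℚ, ∏ j, S.toQ.all j ^ κ j ≠ γ ^ 3)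
    (hΛ : ‖S.Λ₀‖ ≤ Real.exp (-P.Uℓ)) {J : ℕ} (hJ : J < P.J₀3) :
    S.ThirdStep (h := P.hparℓ) (Lb := P.Lb3) P.J₀3 J P.L3 P.Lθ3 P.S₀3 P.T3 (P.tJ3 J / 2)
      ⌈((S.toQ.box3 (h := P.hparℓ) (Lb := P.Lb3) P.L3 P.Lθ3 0).card : ℝ) * P.Amax3⌉ := by
  classical
  have hΛ8 : ‖S.Λ₀‖ ≤ (8 : ℝ)⁻¹ := hΛ.trans P.exp_neg_U3_le
  -- the box and the per-`(s,τ)` data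
  set box := S.toQ.box3 (h := P.hparℓ) (Lb := P.Lb3) P.L3 P.Lθ3 J with hbox
  set D : ℕ → Tau S.d → ℕ := fun s τ => S.toQ.Dclear3 (h := P.hparℓ) J P.L3 P.Lθ3 s τ with hDdef
  have hD : ∀ s τ, 1 ≤ D s τ := fun s τ => S.toQ.Dclear3_pos J P.L3 P.Lθ3 s τ
  set Mb : ℕ → Tau S.d → ℝ := fun s τ => max P.MmaxT3
      (∑ u ∈ box, ((⌈((S.toQ.box3 (h := P.hparℓ) (Lb := P.Lb3) P.L3 P.Lθ3 0).card : ℝ) * P.Amax3⌉ : ℤ) : ℝ) *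
        |((S.toQ.qΔ3 P.J₀3 (J + 1) u τ.1 s * S.frame.qA u τ.2 * S.toQ.qEt u s : ℚ) : ℝ)|) with hMbdef
  have hMb : ∀ s τ, 1 ≤ Mb s τ := fun s τ => le_trans P.one_le_MmaxT3 (le_max_left _ _)
  -- on the relevant range `Mb = MmaxT3` and `D ≤ DmaxT3`
  have hMbeq : ∀ s, s < 3 ^ (J + 1) * P.S₀3 → ∀ τ : Tau S.d, tauNorm τ ≤ P.T3 → Mb s τ = P.MmaxT3 := by
    intro s hs τ hτ
    refine max_eq_left ((S.thirdMb_of_bound P.J₀3 J box τ s (S.Pint3_nonneg P)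
      fun u hu => hy.abs_thirdWeight_le_RThird3 hJ hu hτ hs).trans ?_)
    have hcard := S.toQ.card_box3_le_𝔔3 P J
    have hPr := S.Pint3_le_PrV3 P
    have hP0 := S.Pint3_nonneg P
    have hR : (0 : ℝ) ≤ P.RThird3 := P.RThird3_pos.le
    have h𝔔 : (0 : ℝ) ≤ P.𝔔3 := P.𝔔3_pos.le
    unfold PadicW80ParL.MmaxT3
    gcongr
  have hDle : ∀ s, s < 3 ^ (J + 1) * P.S₀3 → ∀ τ : Tau S.d, tauNorm τ ≤ P.T3 → (D s τ : ℝ) ≤ P.DmaxT3 := by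
    intro s hs τ hτ
    have hs' : s < 3 ^ (0 + 1 + J) * P.S₀3 := by rwa [zero_add, Nat.add_comm 1 J]
    have h := hy.Dclear3_le_DmaxK3 (k := 0) hτ hs'
    rwa [S.DmaxK3_zero P] at h
  -- the third-point inequality at the closed forms
  have hHp1 := S.one_le_prod_max_one_abs_all
  have hHp0 : 0 < ∏ i, max 1 |(S.toQ.all i : ℝ)| := lt_of_lt_of_le one_pos hHp1
  have hHp := S.prod_max_one_abs_all_le P hy
  have hfin := S.thirdFinal3_of_log_ineq (h := P.hparℓ) (Lb := P.Lb3) (3 ^ (S.d + J) * P.S₀3) (P.tJ3 J / 2)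
    (3 ^ (S.d + 1 + 1) - 1) hΛ P.DmaxT3_pos P.MmaxT3_pos hHp0 (P.third3_h1 hℓ1 hJ hHp1 hHp)
    (P.third3_h2 hℓ1 hJ hHp1 hHp)
  refine S.thirdStep_of_numerics hJ (P.one_le_tJ3_half hJ) hΛ8 (fun _ hτ => P.room3_of_half J hτ) hint hind
    D hD (fun s τ u hu => S.toQ.exists_int_Dclear3_mul_thirdWeight P.J₀3 J hu τ s) Mb hMb
    (fun s τ => le_max_right _ _) ?_
  intro s hs _h3 τ hτ
  have hτT : tauNorm τ ≤ P.T3 := by have := Nat.div_le_self P.T3 (3 ^ (J + 1)); omega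
  rw [hMbeq s hs τ hτT]
  refine lt_of_lt_of_le hfin ?_
  have hD0 : (0 : ℝ) < D s τ := by exact_mod_cast hD s τ
  exact SetupQ.thirdThreshold_anti hD0 (hDle s hs τ hτT) P.MmaxT3_pos le_rfl hHp0 _

/-! ### The pack -/

include hy in
/-- **The parameter pack of the `2`-adic machine at p1's `q = 3` record** (`ℓ = 1`, `Mcl = 1`), every input of
`TwoSetup.main3` discharged from the height link, the integrality and the cube-Kummer condition of the
generators, at HALF multiplicity `t_J := ⌊tJ3 J/2⌋`. [cite: Yu1989, §3] [cite: Waldschmidt1980, Prop. 3.8 (p. 263)] -/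
theorem paramPack3_nonempty (hint : ∀ i, ∃ a : ℤ, S.toQ.all i = a)
    (hind : ∀ κ : Fin (S.d + 1) → ℕ, (∃ j, ¬ 3 ∣ κ j) → ∀ γ : ℚ, ∏ j, S.toQ.all j ^ κ j ≠ γ ^ 3)
    (hℓ1 : P.ℓ = 1) (_hMcl : P.Mcl = 1) : Nonempty (S.ParamPack3 P.Uℓ) := ⟨{
  h := P.hparℓ
  Lb := P.Lb3
  J₀ := P.J₀3
  L := P.L3
  Lθ := P.Lθ3
  S₀ := P.S₀3
  T := P.T3
  P := ⌈((S.toQ.box3 (h := P.hparℓ) (Lb := P.Lb3) P.L3 P.Lθ3 0).card : ℝ) * P.Amax3⌉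
  t := fun J => P.tJ3 J / 2
  Dmax := fun _ k => P.DmaxK3 k
  Mmax := fun _ k => P.MmaxK3 k
  ht := fun _ hJ => P.one_le_tJ3_half hJ
  hU8 := P.log_eight_le_U3
  hsz := fun _ hJ _ inv => kSizes3_of_hyp hy hJ _ (S.Pint3_le_PrV3 P) inv
  hfin := fun hΛ _ hJ => S.kFinal3_of_record P hℓ1 hΛ hJ
  hthird := fun hΛ _ hJ => thirdStep_of_hyp hy hℓ1 hint hind hΛ hJ
  hsiegel := siegel3_of_hyp hy
  hend := S.endgame3_of_record P _ }⟩

include hy in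
/-- **`‖Λ₀‖₂ > e^{−U}` at p1's record, `2`-adic machine** — all inputs of the triadic descent discharged. [folklore] -/
theorem norm_Λ₀_gt_two (hint : ∀ i, ∃ a : ℤ, S.toQ.all i = a)
    (hind : ∀ κ : Fin (S.d + 1) → ℕ, (∃ j, ¬ 3 ∣ κ j) → ∀ γ : ℚ, ∏ j, S.toQ.all j ^ κ j ≠ γ ^ 3)
    (hℓ1 : P.ℓ = 1) (hMcl : P.Mcl = 1) : Real.exp (-P.Uℓ) < ‖S.Λ₀‖ := by
  obtain ⟨pk⟩ := paramPack3_nonempty hy hint hind hℓ1 hMcl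
  exact not_le.mp (S.not_norm_Λ₀_le_of_paramPack3 pk)

/-! ### Packs exist; the core bound; THE ENGINE at `p = 2` (p3-g3's tail on `recordOf`) -/

/-- **Packs exist** for every `2`-adic set-up with `d ≥ 1` (integer cube-Kummer generators, heights
`≤ V`, floors `1 ≤ V ≤ Vmax`, `1 ≤ W`): at the exponent `2·Cw(d+1)·(∏ Vⱼ·V_θ)·(W + log 2Vmax)·log 2Vmax`
(the record is p3's `recordOf` — p1's `PadicW80ParL` at `ℓ = 1`, `Mcl = 1` —, the exponent bound its envelope
`recordOf_U_le`, and `ParamPack3.mono`). [cite: Waldschmidt1980, Prop. 3.8 (p. 263)] [cite: Yu1990, Theorem 2.1] -/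
theorem packs_exist_two (S : TwoSetup) (V : Fin S.d → ℝ) (Vθ Vmax W : ℝ) (hd : 1 ≤ S.d)
    (hint : ∀ i, ∃ a : ℤ, S.toQ.all i = a)
    (hK : ∀ κ : Fin (S.d + 1) → ℕ, (∃ j, ¬ 3 ∣ κ j) → ∀ γ : ℚ, ∏ j, S.toQ.all j ^ κ j ≠ γ ^ 3)
    (hV : ∀ j, logHeight₁ (S.α j) ≤ V j) (hVθ : logHeight₁ S.θ ≤ Vθ)
    (hV1 : ∀ j, 1 ≤ V j) (hVθ1 : 1 ≤ Vθ) (hVm : ∀ j, V j ≤ Vmax) (hVθm : Vθ ≤ Vmax)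
    (hW : ∀ j, Real.log (max 3 (|S.b j| : ℝ)) ≤ W) (hWθ : Real.log (max 3 (|S.bθ| : ℝ)) ≤ W)
    (hW1 : 1 ≤ W) :
    Nonempty (S.ParamPack3 ((2 * PadicW80Par.Cw (S.d + 1)) * ((∏ j, V j) * Vθ) *
      (W + Real.log (2 * Vmax)) * Real.log (2 * Vmax))) := by
  obtain ⟨pk⟩ := paramPack3_nonempty (P := S.recordOf V Vθ Vmax W hd hV1 hVθ1 hVm hVθm hW1)
    (S.sizeHyp_of_logHeight hV hW hVθ hWθ) hint hK rfl rfl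
  exact ⟨pk.mono (S.recordOf_U_le V Vθ Vmax W hd hV1 hVθ1 hVm hVθm hW1)⟩

/-- **The core bound of the `2`-adic machine holds** with `C m = 2·Cw m = 2(2⁶⁹m)^m` (packs for `d ≥ 1`,
Liouville for `d = 0` via p3's `twoCoreBound_of_packs`). [cite: Yu1990, Theorem 2.1] -/
theorem twoCoreBound_holds : TwoCoreBound (fun m => 2 * PadicW80Par.Cw m) := by
  refine twoCoreBound_of_packs (by show (3 : ℝ) ≤ 2 * PadicW80Par.Cw 1; unfold PadicW80Par.Cw; norm_num) ?_
  intro S V Vθ Vmax W hd hint hK _hμ hV hVθ hV1 hVθ1 hVm hVθm hW hWθ hW1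
  exact packs_exist_two S V Vθ Vmax W hd hint hK hV hVθ hV1 hVθ1 hVm hVθm hW hWθ hW1

/-- **THE ENGINE at `p = 2`** — the Waldschmidt-shape `2`-adic linear-forms bound for integer generators
`≡ 1 (mod 8)` satisfying the cube-Kummer condition (`C(m) = 6·Cw(m) ≤ (3·2⁷⁰)^m m^m`): literally the
hypothesis of lit's `YuNinetyW80.two_of_w80Engine_int'`, by p3's `engineTwoW80_of_coreBound`.
[cite: Yu1990, Theorem 2.1 and §1.1] [cite: Waldschmidt1980, Prop. 3.8] -/
theorem engineTwoW80 :
    ∃ (C : ℕ → ℝ) (c₁ : ℝ), 1 ≤ c₁ ∧ (∀ m, 0 ≤ C m ∧ C m ≤ c₁ ^ m * (m : ℝ) ^ m) ∧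
      ∀ (m : ℕ) (α : Fin m → ℚ) (b : Fin m → ℤ) (V : Fin m → ℝ) (Vmax W : ℝ),
        (∀ j, 3 ≤ padicValRat 2 (α j - 1)) →
        (∀ j, ∃ a : ℤ, α j = a) →
        (∀ μ : Fin m → ℤ, ∏ j, α j ^ μ j = 1 → μ = 0) →
        (∀ κ : Fin m → ℕ, (∃ j, ¬ 3 ∣ κ j) → ∀ γ : ℚ, ∏ j, α j ^ κ j ≠ γ ^ 3) →
        (∀ j, Height.logHeight₁ (α j) ≤ V j) → (∀ j, 1 ≤ V j) → (∀ j, V j ≤ Vmax) →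
        b ≠ 0 → (∀ j, Real.log (max 3 (|b j| : ℝ)) ≤ W) → 1 ≤ W →
        (padicValRat 2 (∏ j, α j ^ b j - 1) : ℝ) ≤
          C m * (∏ j, V j) * (W + Real.log (2 * Vmax)) * Real.log (2 * Vmax) :=
  engineTwoW80_of_coreBound (C := fun m => 2 * PadicW80Par.Cw m) (c₁ := 2 ^ 70) (by norm_num)
    (fun m hm => by have := PadicW80Par.two_le_Cw hm; change 2 ≤ 2 * PadicW80Par.Cw m; linarith)
    (fun m hm => TwistSetup.two_mul_Cw_le_pow hm) twoCoreBound_holds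

end TwoSetup

end Summit.ABC.StewartYu

end
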